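import Mathlib
import Literature.Computability.Complexity.RandomKSatLowDegreeHardness
import Literature.Computability.Complexity.RandomKSatEnsembleOGP

/-!
# Birth skeleton of piece `LinearDegreeHardness` (BC2 redirect of `SearchHardWindow`, stmt-PneNP-2460)

Two named stubs and a kernel-checked composition `LinearDegreeHardness_of`. The stubs follow the
landed Huang–Sellke pipeline of this crux (Theorems/OverlapGapAlgebraSearchHardWindow{HsAssembly,
HsAsymptotics, GrandCorrelation, ResampleStability, Moat, MoatTransfer, EnsembleOGPHolds}.lean) with ONE
change of scale: the resampling rate is a CONSTANT over `n`, `ε = λ / n` (`λ = log(1/δ)` downstream),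
instead of `log(n / D n) / n` with `D = o(n)`.

* `stub_linObstructions` — Huang–Sellke Lemmas 3.22 (ensemble OGP) and 3.23 (chaos) on the
  `λ/n`-resampling chain, for every rate constant `λ ≥ λ₀(k, b)`, with the exponent `c` UNIFORM in the
  rate `λ`, the output maps `a` and the length exponent `A` (the printed first moments — "upper bounded
  by the case `t₀ = ⋯ = t_k`", union bound over `n^{O(1)}` time tuples; chaos via
  `E ≥ 1 − e^{−1/(bk)}` — do not see the scale of `ε` as long as the time gaps are `1/(b k ε)`).
  Size L: re-run of `huangSellke2025KSatEnsembleOGP_holds` / the chaos computation at the new rate.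
* `stub_linAssembly` — the obstructions at constant rate imply `LinearDegreeHardness`: at one large
  `k`, given `(C, p)`, take `b = b₁`, the uniform `c` and `λ₀`, then `δ` so small that
  `log(1/δ) ≥ λ₀`, `u := 2ε(1 + ε m k)(⌊δ n⌋ + 1) C/θ ≤ p²/2` (`ε = log(1/δ)/n`; `u → 0` with `δ`) and
  `log(1/δ) > 2 log(2/p²)/(b c)` (so that `2 e^{−cn} < (p²/2)^{2T}` with `T = k ⌈1/(b k ε)⌉ ≤ n²`);
  then `hsA_core` verbatim (grand correlation ≥ `(p²/2)^{2T}`, moat ≤ `2 e^{−cn}`). Size L: re-run of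
  `stub_hsAssembly` + a linear-degree `hsAsymptotics`.

Neither stub is cheaply the piece or the summit: `stub_linObstructions` is a statement about solution
geometry on the chain (no maps of bounded degree in it), `stub_linAssembly` is an implication with an
open antecedent. Planner planner-cstrat-stmt-PneNP-2460-r1-0, 2026-08-17.
-/

set_option linter.dupNamespace false

noncomputable section

namespace Summit.PneNP.PneNP.Cruxes.SearchHardWindow.LinearDegreeRedirect

open Finset Filter Asymptotics
open Literature.Computability.Complexity
open scoped Classical

/-- The piece, verbatim (as rendered in the route file after the split). -/
def LinearDegreeHardness : Prop :=
  ∃ k₀ : ℕ, ∀ k ≥ k₀, ∀ C : ℝ, 0 < C → ∀ ε : ℝ, 0 < ε → ∃ δ : ℝ, 0 < δ ∧ ∀ F : (n : ℕ) → (m : ℕ) → (Fin m → Fin k → Fin n × Bool) → Fin n → ℝ, (∀ (n m : ℕ) (v : Fin n), Literature.Computability.Complexity.IsCoordDegreeLE ⌊δ * n⌋₊ (fun y : Fin m × Fin k → Fin n × Bool => F n m (Function.curry y) v)) → (∀ n m : ℕ, m = ⌊5 * 2 ^ k * Real.log k / k * n⌋₊ → ∑ Φ : Fin m → Fin k → Fin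 n × Bool, ∑ v : Fin n, F n m Φ v ^ 2 ≤ C * n * Fintype.card (Fin m → Fin k → Fin n × Bool)) → ∀ᶠ n : ℕ in Filter.atTop, ∀ m : ℕ, m = ⌊5 * 2 ^ k * Real.log k / k * n⌋₊ → ((Finset.univ.filter fun Φ : Fin m → Fin k → Fin n × Bool => (∀ v : Fin n, 1 ≤ |F n m Φ v|) ∧ ∀ i : Fin m, ∃ j : Fin k, decide (0 ≤ F n m Φ (Φ i j).1) = (Φ i j).2).card : ℝ) ≤ ε * Fintype.card (Fin m → Fin k → Fin n × Bool)

/-- **Linear-rate obstructions** (HS25 Lemmas 3.22–3.23 on the `λ/n`-resampling chain, exponent `c`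
uniform in the rate, the output maps and the length exponent). -/
def LinObstructions (k : ℕ) : Prop :=
  ∃ β η : ℝ, 0 < η ∧ η < β ∧ ∃ b₁ : ℝ, 0 < b₁ ∧
    ∀ b : ℝ, 0 < b → b ≤ b₁ → ∃ c : ℝ, 0 < c ∧ ∃ lam₀ : ℝ, 0 < lam₀ ∧ ∀ lam : ℝ, lam₀ ≤ lam →
      ∀ (a : (n m : ℕ) → (Fin m × Fin k → Fin n × Bool) → (Fin n → Bool)) (A : ℕ),
      ∀ᶠ n : ℕ in atTop, ∀ m : ℕ, m = ⌊5 * 2 ^ k * Real.log k / k * n⌋₊ →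
        ∀ ε : ℝ, ε = lam / n → ∀ K : ℕ, K ≤ n ^ A →
        resampleChainMass ε K (fun y : ℕ → (Fin m × Fin k → Fin n × Bool) =>
            ∃ (t : ℕ → ℕ) (x : ℕ → Fin n → Bool), (∀ ℓ < k, t ℓ ≤ t (ℓ + 1)) ∧ t k ≤ K ∧
              (∀ ℓ ≤ k, ∀ i : Fin m, ∃ j : Fin k, x ℓ (y (t ℓ) (i, j)).1 = (y (t ℓ) (i, j)).2) ∧
              ∀ ℓ, 1 ≤ ℓ → ℓ ≤ k → overlapCondEnt x ℓ ∈ Set.Icc (β - η) β)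
          ≤ Real.exp (-(c * n)) ∧
        resampleChainMass ε K (fun y : ℕ → (Fin m × Fin k → Fin n × Bool) =>
            ∃ (j : ℕ) (t : ℕ → ℕ) (x : Fin n → Bool), 1 ≤ j ∧ j ≤ k ∧
              (∀ ℓ < j, t ℓ ≤ t (ℓ + 1)) ∧ t j ≤ K ∧ (t (j - 1) : ℝ) + 1 / (b * k * ε) ≤ t j ∧
              (∀ i : Fin m, ∃ j' : Fin k, x (y (t j) (i, j')).1 = (y (t j) (i, j')).2) ∧
              overlapCondEnt (fun ℓ => if ℓ < j then a n m (y (t ℓ)) else x) j ≤ β)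
          ≤ Real.exp (-(c * n))

/-- Stub 1 (size L): the obstructions at constant rate, for all large `k`.
[HuangSellke2025, Lemmas 3.22–3.23; BreslerHuang2022, Prop. 4.7] -/
theorem stub_linObstructions : ∃ k₀ : ℕ, ∀ k ≥ k₀, LinObstructions k := by
  sorry

/-- Stub 2 (size L): Huang–Sellke's assembly (grand correlation + `L²`-stability/Markov + moat) run at
degree `⌊δ n⌋`, rate `ε = log(1/δ)/n`, `T = k ⌈1/(b k ε)⌉`, with `δ = δ(k, C, p)` chosen after the
uniform exponent `c`. [HuangSellke2025, Cor. 3.21, Lemma 3.15, Prop. 3.14, Lemmas 3.24–3.25] -/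
theorem stub_linAssembly : (∃ k₀ : ℕ, ∀ k ≥ k₀, LinObstructions k) → LinearDegreeHardness := by
  sorry

/-- **Composition.** The two stubs give the piece. -/
theorem LinearDegreeHardness_of : LinearDegreeHardness :=
  stub_linAssembly stub_linObstructions

end Summit.PneNP.PneNP.Cruxes.SearchHardWindow.LinearDegreeRedirect

end
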